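import Summits.QuantumFields.YangMills.Theorems.AllWindowsColdBoxBoxHighLineOrbitMapContraction
import Summits.QuantumFields.YangMills.Theorems.AllWindowsColdBoxBoxHighLineFPOperatorInverseRowSums

/-!
# J2∞ «`OrbitMapContraction` in the sup norm»: `|((1 − F_V⁻¹·DΨ_V(v)) w)_i| ≤ C·H²·a·max_j |w_j|` on the sup-box `‖A_x‖ ≤ a ≤ 1`

Width seat `ym-line-sfw-p2-w2` (prover-ym-line-sfw-p2-w2-g32-0), free hands for planner ym-idea-2 g18's recorded lift **L1** of blocker **B1** of the
next rung U5 (`Cruxes/BoxWindowHighSU2213/U5-BLOCKERS.md` §1–§2).  B1: the S5 chain does the J2/J4 fixed point in `ℓ²`, where the contraction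
radius `1/(2C H⁴ (1+log β)²)` must exceed the Gaussian `ℓ²`-radius `≍ H² β^{-1/2}` — the window `12θ < 1`.  L1: «redo J2 `OrbitMapContraction` and J4
`OrbitMapBulkSurj` in `ℓ^∞` instead of `ℓ²`» (the Gaussian lives at sup-norm radius `β^{-1/2}·polylog`).  This file is the FIRST of the two bricks:
my lineage's ✓J2 (`…OrbitMapContraction`, seat w2 g30) VERBATIM with sup norms in place of `dotProduct`s, and with the SAME `H²` (no logarithm),
because the `ℓ^∞ → ℓ^∞` norm of `F_V⁻¹` is `≤ C·H²` on the whole `r₀`-ball (✓`OrbitMapSup.fpOperator_inv_row_abs_le`, the companion file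
`…FPOperatorInverseRowSums`, over ✓T-S5.4f-i/ii):

with `W = V^{pauliGauge A}`, `A = ♭⁻¹v`, `DΨ_V(v) = F(W)·J` (✓J1 `OrbitChart.hasFDerivAt_orbitMapFlat_matrix`, `J = pauliJac H v`), the algebra is
`1 − F_V⁻¹ F(W) J = (1 − J) + F_V⁻¹ (F_V − F(W)) J`, and in the sup norm

* `OrbitMapSup.abs_le_of_sum_sq_le`, `norm_vecToField_le_two_mul` — `ℓ² ↔ ℓ^∞` on the three colours (`√3 ≤ 2`);
* `OrbitMapSup.jacBlock_sub_abs_le` — the flat chart block: `X(z) = gSer(ad(−X A))(X u)`, `‖A‖ ≤ s ≤ 1`, `|u_c| ≤ M` ⟹ `|z_c − u_c| ≤ 1502·s·M`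
  (✓`jacBlock_sub_sq_le`: `858·√3 ≤ 1502`); block-diagonal sums `OrbitMapSup.abs_one_sub_jac_mulVec_le` / `abs_jac_mulVec_le`
  (`|((1 − J)w)_i| ≤ 1502·a·M`, `|(Jw)_i| ≤ (1 + 1502a)·M`);
* the link displacement `‖W_e − V_e‖ ≤ 24a` (✓`norm_coe_gaugeTransformZd_pauliGauge_sub_le`) and the `ℓ^∞` form of 4c-E
  (✓`OrbitMapSup.abs_fpOperator_sub_mulVec_le`: `|((F_V − F(W)) u)_p| ≤ 48·24a·(2(1 + 1502a)M)`);
* **`OrbitMapSup.orbitMap_contraction_sup_core`** — the matrix-level estimate for ANY `J` with the flat-block structure, and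
* ★★ **`OrbitMapSup.orbitMap_contraction_sup`** — the by-name form with `fderiv ℝ (orbitMapFlat H V) v`:
  `∃ C > 0, ∀ H ≥ 1, ∀ r₀ a, 0 ≤ r₀ → 0 ≤ a ≤ 1 → C·r₀·H² ≤ 1 → ∀ V (links within defect r₀²), IsUnit (det F_V) ∧ ∀ v (‖(♭⁻¹v)_x‖ ≤ a) ∀ w M
  (|w_j| ≤ M), ∀ i, |(w − F_V⁻¹·(fderiv ℝ (orbitMapFlat H V) v) w)_i| ≤ C·H²·a·M`,
  plus the Pi-norm corollary `OrbitMapSup.norm_sub_inv_mulVec_fderiv_le` (`‖(1 − F_V⁻¹ DΨ_V(v)) w‖ ≤ C·H²·a·‖w‖` for Mathlib's sup norm on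
  `ι → ℝ` — the Lipschitz input of the `ℓ^∞` Banach fixed point J4∞).

So the `ℓ^∞` contraction constant is `C·H²·a` exactly as in `ℓ²`; with `a ≍ H² β^{-1/2} polylog` (`= ‖F_V⁻¹‖_{∞→∞} ×` the sup size of the Gaussian)
the J4∞ window is `H⁴ β^{-1/2} polylog ≪ 1`, i.e. **`8θ < 1`** (memo §2 L1, first branch; the «`H³` boundary layer» branch does not occur).

Everything proved; no definitions; Mathlib + tree only; standard axioms.  HONEST LABEL: a glue brick for the recorded lift L1 of the NEXT rung U5
(LINE-20 ⟨stmt-QuantumFields-24336⟩, unstaffed, gated by the critic's N2/I23); J4∞ and the other lifts L2–L5 are not here; S5, U5, ⟨24004⟩ ⟨24335⟩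
⟨24336⟩ remain OPEN; no stub is closed by name; no crux, rung or summit is proved; **the Yang–Mills mass gap is NOT proved by this file; no summit is
proved by a line.**
-/

set_option autoImplicit false

noncomputable section

open Matrix Finset NormedSpace
open scoped Matrix.Norms.Operator
open Literature.MathematicalPhysics.QuantumFieldTheory.Balaban1983to89.B10Eq18SigmaSU2 (su2Coord)
open Literature.MathematicalPhysics.QuantumFieldTheory.Balaban1983to89.B10Eq18SigmaSU2Haar (expPauli)
open Literature.MathematicalPhysics.QuantumFieldTheory.AxialGauge (boxEdges)
open Literature.MathematicalPhysics.QuantumLattice (LGConfig ZdEdge gaugeTransformZd)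
open Literature.Probability.LatticeModels (Site)
open Literature.Analysis.Calculus.ExpDifferential (gSer ad)

namespace Summit.QuantumFields.YangMills.Theorems.AllWindowsColdBoxBoxHighLine

namespace OrbitMapSup

variable {H : ℕ}

/-! ## `ℓ² ↔ ℓ^∞` on three colours -/

/-- If `Σ_c x_c² ≤ 3·B²` with `B ≥ 0` then `|x_c| ≤ 2·B` for every colour (`√3 ≤ 2`). -/
theorem abs_le_of_sum_sq_le (x : Fin 3 → ℝ) {B : ℝ} (hB : 0 ≤ B) (h : ∑ c : Fin 3, x c ^ 2 ≤ 3 * B ^ 2) (c : Fin 3) :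
    |x c| ≤ 2 * B := by
  have hc : x c ^ 2 ≤ ∑ c' : Fin 3, x c' ^ 2 := Finset.single_le_sum (fun c' _ => sq_nonneg (x c')) (Finset.mem_univ c)
  refine abs_le_of_sq_le_sq ?_ (by positivity)
  nlinarith

/-- Three colours bounded by `M` have square sum `≤ 3M²`. -/
theorem sum_sq_le_three_mul_sq (u : Fin 3 → ℝ) {M : ℝ} (hu : ∀ c, |u c| ≤ M) : ∑ c : Fin 3, u c ^ 2 ≤ 3 * M ^ 2 := by
  calc ∑ c : Fin 3, u c ^ 2 ≤ ∑ _c : Fin 3, M ^ 2 := Finset.sum_le_sum fun c _ => by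
          rw [← sq_abs]; exact pow_le_pow_left₀ (abs_nonneg _) (hu c) 2
    _ = 3 * M ^ 2 := by simp

/-- The interior field of a coordinate vector with `|u_j| ≤ M` has pointwise norm `≤ 2M`. -/
theorem norm_vecToField_le_two_mul (u : ↥(interiorSites H) × Fin 3 → ℝ) {M : ℝ} (hu : ∀ j, |u j| ≤ M) (y : ↥(interiorSites H)) :
    ‖vecToField H u y‖ ≤ 2 * M := by
  have hM : 0 ≤ M := (abs_nonneg _).trans (hu (y, 0))
  rw [EuclideanSpace.norm_eq]
  have h3 : ∑ b : Fin 3, ‖vecToField H u y b‖ ^ 2 ≤ 3 * M ^ 2 := by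
    have := sum_sq_le_three_mul_sq (fun c => u (y, c)) (fun c => hu (y, c))
    refine le_of_eq_of_le ?_ this
    exact Finset.sum_congr rfl fun b _ => by rw [vecToField_apply, Real.norm_eq_abs, sq_abs]
  calc Real.sqrt (∑ b : Fin 3, ‖vecToField H u y b‖ ^ 2) ≤ Real.sqrt (3 * M ^ 2) := Real.sqrt_le_sqrt h3
    _ ≤ Real.sqrt ((2 * M) ^ 2) := Real.sqrt_le_sqrt (by nlinarith)
    _ = 2 * M := Real.sqrt_sq (by positivity)

/-! ## The flat chart blocks in the sup norm: `|z_c − u_c| ≤ 1502·‖A‖·max|u|` -/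

/-- **The flat chart block is `1502‖A‖`-close to the identity in the sup norm**: if `X(z) = gSer(ad(−X(A)))(X(u))`, `‖A‖ ≤ s ≤ 1` and `|u_c| ≤ M`
for all `c`, then `|z_c − u_c| ≤ 1502·s·M` (✓`jacBlock_sub_sq_le` and `858·√3 < 1502`). -/
theorem jacBlock_sub_abs_le (A : EuclideanSpace ℝ (Fin 3)) {s : ℝ} (hs1 : s ≤ 1) (hA : ‖A‖ ≤ s) (u z : Fin 3 → ℝ)
    (hz : su2Coord z = gSer ℝ (ad ℝ (-su2Coord (WithLp.ofLp A))) (su2Coord u)) {M : ℝ} (hu : ∀ c, |u c| ≤ M) (c : Fin 3) :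
    |z c - u c| ≤ 1502 * s * M := by
  have hs0 : 0 ≤ s := (norm_nonneg A).trans hA
  have hM : 0 ≤ M := (abs_nonneg _).trans (hu 0)
  have h1 := jacBlock_sub_sq_le A hs1 hA u z hz
  have h2 := sum_sq_le_three_mul_sq u hu
  have hc : (z c - u c) ^ 2 ≤ ∑ c' : Fin 3, (z c' - u c') ^ 2 :=
    Finset.single_le_sum (fun c' _ => sq_nonneg (z c' - u c')) (Finset.mem_univ c)
  refine abs_le_of_sq_le_sq ?_ (by positivity)
  have h3 : (z c - u c) ^ 2 ≤ (858 * s) ^ 2 * (3 * M ^ 2) := hc.trans (h1.trans (mul_le_mul_of_nonneg_left h2 (sq_nonneg _)))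
  nlinarith [sq_nonneg (s * M)]

/-- **Block-diagonal sum, sup norm**: if every `y`-block of `J` is the flat chart block at `(♭⁻¹v)_y` and `‖(♭⁻¹v)_y‖ ≤ a ≤ 1`, then for `|w_j| ≤ M`,
`|((1 − J) w)_i| ≤ 1502·a·M`. -/
theorem abs_one_sub_jac_mulVec_le (v : ↥(interiorSites H) × Fin 3 → ℝ) {a : ℝ} (ha1 : a ≤ 1)
    (hv : ∀ x, ‖vecToField H v x‖ ≤ a) (J : Matrix (↥(interiorSites H) × Fin 3) (↥(interiorSites H) × Fin 3) ℝ)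
    (hJ : ∀ (w : ↥(interiorSites H) × Fin 3 → ℝ) (y : ↥(interiorSites H)),
      su2Coord (fun c => (J *ᵥ w) (y, c)) =
        gSer ℝ (ad ℝ (-su2Coord (WithLp.ofLp (vecToField H v y)))) (su2Coord fun c => w (y, c)))
    (w : ↥(interiorSites H) × Fin 3 → ℝ) {M : ℝ} (hw : ∀ j, |w j| ≤ M) (i : ↥(interiorSites H) × Fin 3) :
    |((1 - J) *ᵥ w) i| ≤ 1502 * a * M := by
  have h := jacBlock_sub_abs_le (vecToField H v i.1) ha1 (hv i.1) (fun c => w (i.1, c)) (fun c => (J *ᵥ w) (i.1, c)) (hJ w i.1)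
    (fun c => hw (i.1, c)) i.2
  rw [Matrix.sub_mulVec, Matrix.one_mulVec, Pi.sub_apply, abs_sub_comm]
  exact h

/-- … and `|(J w)_i| ≤ (1 + 1502·a)·M`. -/
theorem abs_jac_mulVec_le (v : ↥(interiorSites H) × Fin 3 → ℝ) {a : ℝ} (ha1 : a ≤ 1)
    (hv : ∀ x, ‖vecToField H v x‖ ≤ a) (J : Matrix (↥(interiorSites H) × Fin 3) (↥(interiorSites H) × Fin 3) ℝ)
    (hJ : ∀ (w : ↥(interiorSites H) × Fin 3 → ℝ) (y : ↥(interiorSites H)),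
      su2Coord (fun c => (J *ᵥ w) (y, c)) =
        gSer ℝ (ad ℝ (-su2Coord (WithLp.ofLp (vecToField H v y)))) (su2Coord fun c => w (y, c)))
    (w : ↥(interiorSites H) × Fin 3 → ℝ) {M : ℝ} (hw : ∀ j, |w j| ≤ M) (i : ↥(interiorSites H) × Fin 3) :
    |(J *ᵥ w) i| ≤ (1 + 1502 * a) * M := by
  have h := abs_one_sub_jac_mulVec_le v ha1 hv J hJ w hw i
  rw [Matrix.sub_mulVec, Matrix.one_mulVec, Pi.sub_apply] at h
  have := abs_sub_abs_le_abs_sub (w i) ((J *ᵥ w) i)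
  have hwi := hw i
  rw [abs_sub_comm] at h
  have h' : |(J *ᵥ w) i| - |w i| ≤ 1502 * a * M := (abs_sub_abs_le_abs_sub _ _).trans h
  linarith

/-! ## The matrix-level contraction bound in the sup norm -/

/-- **J2∞ CORE (matrix level).**  One constant `C > 0`: for `H ≥ 1`, `C·r₀·H² ≤ 1`, `V` with cold-box links within defect `r₀²` of `1`, a coordinate
vector `v` with `‖(♭⁻¹v)_x‖ ≤ a ≤ 1`, and ANY matrix `J` whose `y`-blocks are the flat chart blocks at `(♭⁻¹v)_y`:
`|(w − F_V⁻¹·(F(V^{pauliGauge ♭⁻¹v})·J) w)_i| ≤ C·H²·a·M` whenever `|w_j| ≤ M` for all `j`. -/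
theorem orbitMap_contraction_sup_core : ∃ C : ℝ, 0 < C ∧ ∀ H : ℕ, 1 ≤ H → ∀ r₀ a : ℝ, 0 ≤ r₀ → 0 ≤ a → a ≤ 1 →
    C * r₀ * (H : ℝ) ^ 2 ≤ 1 → ∀ V : LGConfig 4 SU2, (∀ e ∈ boxEdges 4 (2 * H + 1), linkDefect V e ≤ r₀ ^ 2) →
      IsUnit (fpOperator H V).det ∧
      ∀ v : ↥(interiorSites H) × Fin 3 → ℝ, (∀ x, ‖vecToField H v x‖ ≤ a) →
        ∀ J : Matrix (↥(interiorSites H) × Fin 3) (↥(interiorSites H) × Fin 3) ℝ,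
          (∀ (w : ↥(interiorSites H) × Fin 3 → ℝ) (y : ↥(interiorSites H)),
            su2Coord (fun c => (J *ᵥ w) (y, c)) =
              gSer ℝ (ad ℝ (-su2Coord (WithLp.ofLp (vecToField H v y)))) (su2Coord fun c => w (y, c))) →
          ∀ (w : ↥(interiorSites H) × Fin 3 → ℝ) (M : ℝ), (∀ j, |w j| ≤ M) → ∀ i,
            |(w - (fpOperator H V)⁻¹ *ᵥ
                ((fpOperator H (gaugeTransformZd (pauliGauge H (vecToField H v)) V) * J) *ᵥ w)) i| ≤ C * (H : ℝ) ^ 2 * a * M := by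
  obtain ⟨CF, hCF, hF⟩ := abs_fpOperator_inv_mulVec_le
  refine ⟨1502 + 3462912 * CF + CF, by positivity, fun H hH r₀ a hr₀ ha0 ha1 hC V hV => ?_⟩
  have hH' : (1 : ℝ) ≤ H := by exact_mod_cast hH
  have hH2 : (1 : ℝ) ≤ (H : ℝ) ^ 2 := one_le_pow₀ hH'
  -- the regime of the companion file
  have hCF' : CF * r₀ * (H : ℝ) ^ 2 ≤ 1 := by
    have : CF * r₀ * (H : ℝ) ^ 2 ≤ (1502 + 3462912 * CF + CF) * r₀ * (H : ℝ) ^ 2 := by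
      have h0 : 0 ≤ r₀ * (H : ℝ) ^ 2 := by positivity
      nlinarith
    exact this.trans hC
  obtain ⟨hU, hFinv⟩ := hF H hH r₀ hr₀ hCF' V hV
  refine ⟨hU, fun v hv J hJ w M hw i => ?_⟩
  have hM : 0 ≤ M := (abs_nonneg _).trans (hw i)
  set W : LGConfig 4 SU2 := gaugeTransformZd (pauliGauge H (vecToField H v)) V with hWdef
  set u : ↥(interiorSites H) × Fin 3 → ℝ := J *ᵥ w with hu
  -- sizes of `u = J w`
  have hu_abs : ∀ j, |u j| ≤ (1 + 1502 * a) * M := fun j => abs_jac_mulVec_le v ha1 hv J hJ w hw j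
  have hu_field : ∀ y, ‖vecToField H u y‖ ≤ 2 * ((1 + 1502 * a) * M) := norm_vecToField_le_two_mul u hu_abs
  -- link displacement `‖V_e − W_e‖ ≤ 24a`
  have hδ : ∀ e ∈ boxEdges 4 (2 * H + 1), ‖(V e : Matrix (Fin 2) (Fin 2) ℂ) - (W e : Matrix (Fin 2) (Fin 2) ℂ)‖ ≤ 24 * a := by
    intro e _
    rw [norm_sub_rev, hWdef, pauliGauge_eq]
    exact norm_coe_gaugeTransformZd_pauliGauge_sub_le V (vecToField H v) ha0 ha1 hv e
  -- `|((F_V − F_W) u)_p| ≤ 48·24a·(2(1+1502a)M)`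
  have hE : ∀ p, |((fpOperator H V - fpOperator H W) *ᵥ u) p| ≤ 48 * (24 * a) * (2 * ((1 + 1502 * a) * M)) := fun p =>
    abs_fpOperator_sub_mulVec_le V W hδ u (by positivity) hu_field p
  -- `|(F_V⁻¹ (F_V − F_W) u)_i| ≤ CF H² · that`
  have hFE := hFinv ((fpOperator H V - fpOperator H W) *ᵥ u) _ hE i
  -- the algebra `w − F_V⁻¹ (F_W u) = (1 − J) w + F_V⁻¹ ((F_V − F_W) u)`
  have hKF : (fpOperator H V)⁻¹ * fpOperator H V = 1 := Matrix.nonsing_inv_mul _ hU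
  have halg : w - (fpOperator H V)⁻¹ *ᵥ ((fpOperator H W * J) *ᵥ w) =
      (1 - J) *ᵥ w + (fpOperator H V)⁻¹ *ᵥ ((fpOperator H V - fpOperator H W) *ᵥ u) := by
    have h1 : (fpOperator H W * J) *ᵥ w = fpOperator H W *ᵥ u := by rw [hu, Matrix.mulVec_mulVec]
    have h2 : (fpOperator H V)⁻¹ *ᵥ ((fpOperator H V - fpOperator H W) *ᵥ u) = u - (fpOperator H V)⁻¹ *ᵥ (fpOperator H W *ᵥ u) := by
      rw [Matrix.sub_mulVec, Matrix.mulVec_sub, Matrix.mulVec_mulVec, hKF, Matrix.one_mulVec]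
    have h3 : (1 - J) *ᵥ w = w - u := by rw [Matrix.sub_mulVec, Matrix.one_mulVec, hu]
    rw [h1, h2, h3]
    abel
  rw [halg, Pi.add_apply]
  have h1 := abs_one_sub_jac_mulVec_le v ha1 hv J hJ w hw i
  calc |((1 - J) *ᵥ w) i + ((fpOperator H V)⁻¹ *ᵥ ((fpOperator H V - fpOperator H W) *ᵥ u)) i|
      ≤ |((1 - J) *ᵥ w) i| + |((fpOperator H V)⁻¹ *ᵥ ((fpOperator H V - fpOperator H W) *ᵥ u)) i| := abs_add_le _ _
    _ ≤ 1502 * a * M + CF * (H : ℝ) ^ 2 * (48 * (24 * a) * (2 * ((1 + 1502 * a) * M))) := add_le_add h1 hFE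
    _ ≤ (1502 + 3462912 * CF + CF) * (H : ℝ) ^ 2 * a * M := by
        have e1 : 1502 * a * M ≤ 1502 * (H : ℝ) ^ 2 * a * M := by
          have : 1502 * a * M * 1 ≤ 1502 * a * M * (H : ℝ) ^ 2 := mul_le_mul_of_nonneg_left hH2 (by positivity)
          linarith
        have e2 : CF * (H : ℝ) ^ 2 * (48 * (24 * a) * (2 * ((1 + 1502 * a) * M))) ≤ 3462912 * CF * (H : ℝ) ^ 2 * a * M := by
          have : (1 + 1502 * a) * M ≤ 1503 * M := mul_le_mul_of_nonneg_right (by linarith) hM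
          have h0 : 0 ≤ CF * (H : ℝ) ^ 2 * (48 * (24 * a)) := by positivity
          nlinarith
        have e3 : 0 ≤ CF * (H : ℝ) ^ 2 * a * M := by positivity
        nlinarith

/-! ## J2∞ by name -/

/-- ★★ **J2∞ — `OrbitMapContraction` in the sup norm, BY NAME** (with `fderiv ℝ (orbitMapFlat H V) v`, via ✓J1 `OrbitChart.hasFDerivAt_orbitMapFlat_matrix`
and ✓`pauliJac_mulVec_slice`/✓`OrbitChart.su2Coord_jPauli` for the block structure of `pauliJac H v`). -/
theorem orbitMap_contraction_sup : ∃ C : ℝ, 0 < C ∧ ∀ H : ℕ, 1 ≤ H → ∀ r₀ a : ℝ, 0 ≤ r₀ → 0 ≤ a → a ≤ 1 →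
    C * r₀ * (H : ℝ) ^ 2 ≤ 1 → ∀ V : LGConfig 4 SU2, (∀ e ∈ boxEdges 4 (2 * H + 1), linkDefect V e ≤ r₀ ^ 2) →
      IsUnit (fpOperator H V).det ∧
      ∀ v : ↥(interiorSites H) × Fin 3 → ℝ, (∀ x, ‖vecToField H v x‖ ≤ a) →
        ∀ (w : ↥(interiorSites H) × Fin 3 → ℝ) (M : ℝ), (∀ j, |w j| ≤ M) → ∀ i,
          |(w - (fpOperator H V)⁻¹ *ᵥ (fderiv ℝ (orbitMapFlat H V) v w)) i| ≤ C * (H : ℝ) ^ 2 * a * M := by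
  obtain ⟨C, hC, h⟩ := orbitMap_contraction_sup_core
  refine ⟨C, hC, fun H hH r₀ a hr₀ ha0 ha1 hCr V hV => ⟨(h H hH r₀ a hr₀ ha0 ha1 hCr V hV).1, fun v hv w M hw i => ?_⟩⟩
  have hfd : fderiv ℝ (orbitMapFlat H V) v w =
      (fpOperator H (gaugeTransformZd (pauliGauge H (vecToField H v)) V) * OrbitChart.pauliJac H v) *ᵥ w := by
    rw [OrbitChart.fderiv_orbitMapFlat, LinearMap.coe_toContinuousLinearMap', Matrix.toLin'_apply]
  rw [hfd]
  exact (h H hH r₀ a hr₀ ha0 ha1 hCr V hV).2 v hv (OrbitChart.pauliJac H v)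
    (fun w' y => by rw [pauliJac_mulVec_slice, OrbitChart.su2Coord_jPauli]) w M hw i

/-- ★ **Pi-norm corollary** (the Lipschitz input of the `ℓ^∞` Banach fixed point J4∞): with Mathlib's sup norm on `ι → ℝ`,
`‖w − F_V⁻¹·(fderiv ℝ (orbitMapFlat H V) v) w‖ ≤ C·H²·a·‖w‖`. -/
theorem norm_sub_inv_mulVec_fderiv_le : ∃ C : ℝ, 0 < C ∧ ∀ H : ℕ, 1 ≤ H → ∀ r₀ a : ℝ, 0 ≤ r₀ → 0 ≤ a → a ≤ 1 →
    C * r₀ * (H : ℝ) ^ 2 ≤ 1 → ∀ V : LGConfig 4 SU2, (∀ e ∈ boxEdges 4 (2 * H + 1), linkDefect V e ≤ r₀ ^ 2) →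
      IsUnit (fpOperator H V).det ∧
      ∀ v : ↥(interiorSites H) × Fin 3 → ℝ, (∀ x, ‖vecToField H v x‖ ≤ a) →
        ∀ w : ↥(interiorSites H) × Fin 3 → ℝ,
          ‖w - (fpOperator H V)⁻¹ *ᵥ (fderiv ℝ (orbitMapFlat H V) v w)‖ ≤ C * (H : ℝ) ^ 2 * a * ‖w‖ := by
  obtain ⟨C, hC, h⟩ := orbitMap_contraction_sup
  refine ⟨C, hC, fun H hH r₀ a hr₀ ha0 ha1 hCr V hV => ⟨(h H hH r₀ a hr₀ ha0 ha1 hCr V hV).1, fun v hv w => ?_⟩⟩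
  have hw : ∀ j, |w j| ≤ ‖w‖ := fun j => by rw [← Real.norm_eq_abs]; exact norm_le_pi_norm w j
  refine (pi_norm_le_iff_of_nonneg (by positivity)).2 fun i => ?_
  rw [Real.norm_eq_abs]
  exact (h H hH r₀ a hr₀ ha0 ha1 hCr V hV).2 v hv w ‖w‖ hw i

end OrbitMapSup

end Summit.QuantumFields.YangMills.Theorems.AllWindowsColdBoxBoxHighLine

end
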